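import Mathlib
import HarnessLib
import Literature.Analysis.Calculus.SecondDifferenceBound

/-!
# Iterated forward differences of a `Cⁿ` function are bounded by its `n`-th derivative: `‖Δ_δⁿ f‖ ≤ δⁿ sup ‖f⁽ⁿ⁾‖`,
# and iterated differences of SAMPLED functions are the sampled iterated differences

Topic `Literature/Analysis`; continues `SecondDifferenceBound.lean` (there: `n = 1, 2`).  The discrete differences of a lattice
symbol that is the restriction of a smooth function — a propagator symbol sampled at the Matsubara frequencies `ω̃_{q₀} + k·2π/β`
or at the torus momenta `2π(k⃗ + m e_l)/L` — are controlled by the derivatives of that function (mean value inequality, `n` times):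

* **`norm_fwdDiff_iter_le_of_hasDerivAt`** — for a chain `g 0, g 1, …, g n : ℝ → E` with `(g k)′ = g (k+1)` on `[x, x + nδ]`
  (`k < n`) and `‖g n‖ ≤ B` there: `‖(fwdDiff δ)^[n] (g 0) x‖ ≤ δⁿ·B` (`δ ≥ 0`);
* **`fwdDiff_iter_eq_smul_of_sample`** — if `G (y' + k • h') = K • f (y + k • h)` for `k ≤ n` (a grid function `G` SAMPLES `f`
  along an arithmetic progression, up to a constant factor `K`), then `(fwdDiff h')^[n] G y' = K • (fwdDiff h)^[n] f y`
  (both sides are the same binomial sum, `fwdDiff_iter_eq_sum_shift`).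

This is the input of the weighted-Plancherel `L¹` bounds with MIXED differences in several directions (Benfatto–Giuliani–Mastropietro
2006, Lemma 2.2 / (2.36aa): discrete derivatives of the propagator symbols at finite `(β, L)` in every dual direction; cell
gate-hubbard-kl, the first moments of the scale-`0` step).

Everything is proved; no definitions, no named facts.

## Sources

G. Benfatto, A. Giuliani, V. Mastropietro, Ann. Henri Poincaré 7 (2006) 809–898, Lemma 2.2, (2.36aa) and footnote ¹
(`BenfattoGiulianiMastropietro2006`).
-/

noncomputable section

open Set Finset

namespace Literature.Analysis

variable {E : Type*} [NormedAddCommGroup E] [NormedSpace ℝ E]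

/-- **Iterated mean value inequality**: if `g 0, …, g n : ℝ → E` satisfy `HasDerivAt (g k) (g (k+1) t) t` for `k < n` and
`t ∈ [x, x + nδ]`, and `‖g n t‖ ≤ B` on that segment, then `‖(fwdDiff δ)^[n] (g 0) x‖ ≤ δⁿ B` (`δ ≥ 0`).  (Induction on `n`:
`Δ_δ^{n+1} g₀ = Δ_δⁿ (Δ_δ g₀)`, the chain `k ↦ Δ_δ (g k)` has the differences of the derivatives as derivatives, and
`‖Δ_δ (g n)‖ ≤ δ B` by the mean value inequality.) [cite: BenfattoGiulianiMastropietro2006, (2.36aa)] -/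
theorem norm_fwdDiff_iter_le_of_hasDerivAt {δ : ℝ} (hδ : 0 ≤ δ) :
    ∀ (n : ℕ) (g : ℕ → ℝ → E) (x B : ℝ),
      (∀ k < n, ∀ t ∈ Icc x (x + n * δ), HasDerivAt (g k) (g (k + 1) t) t) →
      (∀ t ∈ Icc x (x + n * δ), ‖g n t‖ ≤ B) → ‖(fwdDiff δ)^[n] (g 0) x‖ ≤ δ ^ n * B := by
  intro n
  induction n with
  | zero =>
    intro g x B _ hB
    simpa using hB x ⟨le_rfl, by simp⟩
  | succ n ih =>
    intro g x B hg hB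
    -- the differenced chain
    set g' : ℕ → ℝ → E := fun k t => g k (t + δ) - g k t with hg'
    have hg'0 : (fwdDiff δ)^[n + 1] (g 0) x = (fwdDiff δ)^[n] (g' 0) x := by
      rw [Function.iterate_succ_apply]
      rfl
    have hder : ∀ k < n, ∀ t ∈ Icc x (x + n * δ), HasDerivAt (g' k) (g' (k + 1) t) t := by
      intro k hk t ht
      have hk' : k < n + 1 := Nat.lt_succ_of_lt hk
      have ht1 : t ∈ Icc x (x + (n + 1 : ℕ) * δ) := ⟨ht.1, by push_cast; nlinarith [ht.2]⟩
      have ht2 : t + δ ∈ Icc x (x + (n + 1 : ℕ) * δ) := ⟨by linarith [ht.1], by push_cast; nlinarith [ht.2]⟩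
      have h1 : HasDerivAt (fun s => g k (s + δ)) (g (k + 1) (t + δ)) t := by
        have := (hg k hk' (t + δ) ht2).comp_add_const t δ
        simpa using this
      exact h1.sub (hg k hk' t ht1)
    have hbd : ∀ t ∈ Icc x (x + n * δ), ‖g' n t‖ ≤ δ * B := by
      intro t ht
      refine norm_sub_le_of_norm_deriv_le (f := g n) (f' := g (n + 1)) hδ (fun s hs => hg n (Nat.lt_succ_self n) s ?_)
        fun s hs => hB s ?_
      · exact ⟨le_trans ht.1 hs.1, by push_cast; nlinarith [hs.2, ht.2]⟩
      · exact ⟨le_trans ht.1 hs.1, by push_cast; nlinarith [hs.2, ht.2]⟩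
    rw [hg'0]
    calc ‖(fwdDiff δ)^[n] (g' 0) x‖ ≤ δ ^ n * (δ * B) := ih g' x (δ * B) hder hbd
      _ = δ ^ (n + 1) * B := by ring

/-- **Iterated differences of a sampled function**: if `G (y' + k • h') = K • f (y + k • h)` for all `k ≤ n`, then
`(fwdDiff h')^[n] G y' = K • (fwdDiff h)^[n] f y` — the `n`-th difference of the grid function along the grid direction `h'` is
the `n`-th difference of the sampled function along `h`, times the normalisation `K`. [cite: BenfattoGiulianiMastropietro2006, Lemma 2.2] -/
theorem fwdDiff_iter_eq_smul_of_sample {M M' R F : Type*} [AddCommMonoid M] [AddCommMonoid M'] [CommRing R] [AddCommGroup F]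
    [Module R F] {G : M' → F} {f : M → F} {y : M} {y' : M'} {h : M} {h' : M'} {K : R} {n : ℕ}
    (hs : ∀ k ≤ n, G (y' + k • h') = K • f (y + k • h)) :
    (fwdDiff h')^[n] G y' = K • (fwdDiff h)^[n] f y := by
  rw [fwdDiff_iter_eq_sum_shift, fwdDiff_iter_eq_sum_shift, Finset.smul_sum]
  refine Finset.sum_congr rfl fun k hk => ?_
  rw [hs k (Nat.lt_succ_iff.1 (Finset.mem_range.1 hk)), smul_comm]

end Literature.Analysis

end
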